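import Literature.Barriers.PneNP.ApproximationMethodLimitProbProofs
import HarnessLib

/-!
# Barrier `ApproximationMethodLimit`: Razborov's limit `ρ(f, 𝓜) ≤ O(n₀ n)` (Pich 2024, Thm. 2), proved

Third companion proof file (D-0014) of `Literature/Barriers/PneNP/ApproximationMethodLimit.lean`,
after `ApproximationMethodLimitProofs.lean` (Prop. 1, `ApproximationMethodSound`) and
`ApproximationMethodLimitProbProofs.lean` (the "moreover" part of Thm. 2,
`ApproximationMethodLimitProb`, with the infrastructure of Pich's proof of Lemma 1: truth tables
`TruthTable`, the approximators `trivApprox` = `C̄_h` and `topApprox` = `D̄_g`, their error sets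
`errAt`/`topErr`, Claim 3.1 one level at a time `trivApprox_succ_ne`/`topApprox_ne`, and the
uniformity of halves and of the four sub-tables `child`). This file DISCHARGES the barrier's
principal named fact `Literature.Barriers.PneNP.ApproximationMethodLimit` (Razborov 1989;
Pich 2024, §3.1 Thm. 2, first part): there is an absolute constant `c` — here `c = 500` — such
that for every `n`, every legitimate model `𝓜` of order `n` of circuits over `{¬, ∨₂, ∧₂}` with
`¬̄ = ¬`, and every `f ∈ F_n` with `n₀` essential inputs, some `g ∈ 𝓜` and at most `c·n₀·n`
error tuples over `𝓜` cover `f ⊕ g` (`M.Covers f (c * n₀ * n)`):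
`theorem ApproximationMethodLimit_holds`.

**The printed proof (Pich 2024, §3.1, arXiv pp. 9–10; `lit read arxiv:2212.09285`).** Lemma 1:
"there is a random variable `𝛅` on `Δ` and a random variable `𝐡` on `𝓜` such that for each `x`,
`Pr[𝐡(x) ≠ f(x)] ≤ 12(n₀+1) Pr[x ∈ 𝛅]`", with `𝐡 := D̄_𝐠`,
`D_g := (C_{f⊕g} ∧ C_{¬g}) ∨ (C_{¬(f⊕g)} ∧ C_g)` for uniformly random `𝐠` and the trivial
exponential-size circuits `C_h := (C_{h¹} ∧ x_m) ∨ (C_{h⁰} ∧ ¬x_m)`, proved through Claim 3.1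
("For each `x`, there are `3+12n` positions of gates in `D_g` … such that for each `g ∈ F_n`
satisfying `D̄_g(x) ≠ f(x)`, we have `x ∈ δ_∘(ē₁, ē₂)`" at one of them) and the fact that "all
functions `f⊕g, ¬g, ¬(f⊕g), g` are uniformly random", `𝛅` being a uniformly random type `⟨m, t⟩`
("`3(n+1)` possible types") with a uniformly random table of that level. Then: "Case I (random
approximators). Consider inputs `x` such that `Pr[𝐡(x) ≠ f(x)] < 1/3`. By (the multiplicative)
Chernoff's bound … we can fix `h_1,…,h_{O(n)}` such that `MAJ(h_1,…,h_{O(n)})` coincides with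
`f` on all such inputs `x`. As the majority function MAJ on `m` inputs is computable by an
`O(m log m)`-size circuit `M`, we set `g := M̄(h_1,…,h_{O(n)})` and conclude that all inputs
`x ∈ g ⊕ f` considered in Case I are covered by `O(n log n) ≤ O(nn₀)` tuples. Here, w.l.o.g.
`n₀ ≥ log n` since otherwise `ρ(f,𝓜) ≤ 2^{n₀} ≤ n`. Case II (random error sets). For inputs `x`
such that `Pr[𝐡(x) ≠ f(x)] ≥ 1/3`, we use the fact that random `δ` covers such `x` with high
probability … Therefore, there are `δ_1,…,δ_{O(nn₀)}` covering all `x`'s considered in Case II."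

**Formalisation (the same architecture; probabilities replaced by finite sums, all constants
explicit; sub-namespace `ApproximationMethod`, continuing the sibling file's).**
* `f` depends only on its essential inputs (`dependsOn_essentialInputs`, from the sibling's
  `apply_eq_of_agree_essential`), so `f(x) = eval τ (x ∘ σ)` for the truth table
  `τ : TruthTable N`, `N = n₀`, of `f` read through `σ : Fin N → Fin n`
  (`exists_comp_of_dependsOn`, `TruthTable.ofFun`); the argument proper is `covers_of_eval`.
* Error TUPLES (what `Covers` lists) on top of the sibling's error SETS: `rootTuple` /
  `topTuple` are the tuple forms of `errAt` / `topErr` (bridges `tupleErr_rootTuple`,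
  `tupleErr_topTuple`, both `rfl`); `pathTuple` gives the `3k` tuples on the path of `C_h`
  consistent with `x`, and iterating `trivApprox_succ_ne` yields Claim 3.1 along the path: off
  their error sets `C̄_h(x) = h(x)` (`trivApprox_apply_of_forall_not_mem`); `allTuples` lists
  all `3(2^k − 1)` tuples of `C_h` (the trivial bound `covers_eval_allTuples`, Pich's "otherwise
  `ρ(f,𝓜) ≤ 2^{n₀}`").
* Lemma 1 as a counting identity: by `sum_half` (the halves of a uniformly random table are
  uniformly random, counting form of the sibling's `TruthTable.avg_half`) the depth-`d` tuple on
  ANY path has the same distribution (`sum_pathTuple_eq`), so the random error set `𝛅` becomes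
  the finite family `fam` on the sample space `Space N = F_N × (3 top gates ⊕ N depths × 3
  gates)` of size `3(N+1)|F_N|` (`card_space`), positional tuples read off the all-`0` path;
  with the sibling's `topApprox_ne` and `child_involutive`, `badCount_le` is Lemma 1 at a point:
  `#{g : D̄_g(x) ≠ f(x)} ≤ 4 · #{ω : x ∈ 𝛅(ω)}`, i.e. `Pr[𝐡(x) ≠ f(x)] ≤ 12(N+1)·Pr[x ∈ 𝛅]`.
* Case I, Chernoff derandomised by the exponential moment:
  `Σ_{g⃗ ∈ F_N^k} Σ_x 2^{#{i : D̄_{g_i}(x) ≠ f(x)}} = Σ_x (|F_N| + W_x)^k`, so some `k`-tuple of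
  voters errs fewer than `k/2` times at every `x` with `3W_x < |F_N|`, once `k ≥ 12n`
  (`18¹² > 4·16¹²`; `exists_voters`). The majority vote is realised inside `𝓜` by a BINARY
  COUNTER (`incApx`, `counterWires`: `k = 2^L − 1` inputs, an `L`-wire register, three binary
  gates `w ∨̄ a`, `w ∧̄ a`, `(w ∨̄ a) ∧̄ ¬(w ∧̄ a)` per bit and input, output the top bit
  `[#ones ≥ 2^{L−1}]`, exact off its `3Lk` error tuples: `exists_threshold_device`) —
  `O(n log n)` tuples as printed, in place of the unspecified `O(m log m)`-size majority circuit.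
* Case II without independence: `Σ_{ω⃗ ∈ Ω^{k'}} #{x ∈ S uncovered by ω⃗} = Σ_{x∈S} miss_x^{k'}`,
  so `k' = K·n` members of the family cover `S` once `2ⁿ(K−1)^{Kn} < K^{Kn}` (`exists_cover`,
  `two_mul_pow_lt_pow`); here `K = 36(N+1)` by Lemma 1 on `S = {x : 3W_x ≥ |F_N|}`.
* Bookkeeping (`covers_of_eval`): if `3·2^N − 3 ≤ 500·N·n` the tree bound suffices (this is
  Pich's "w.l.o.g. `n₀ ≥ log n`" and covers `N = 0`); otherwise `1 ≤ N`, `n < 2^N`,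
  `L = size(12n) ≤ N + 4`, `k ≤ 24n`, and `3Lk + 36(N+1)n ≤ (108N + 324)n ≤ 500·N·n`.

**Design choices.** Everything tree-shaped is the sibling file's (`TruthTable`, `trivApprox`,
`andApx`, `errAt`, `topApprox`, `topErr`, `child`, `lit`, `mem_errSet_iff`); this file adds only
what `Covers` needs beyond Lemma 1's inequality — tuples instead of sets, whole paths instead of
one level, and `ℕ`-valued counts over an explicit sample space (from which the cover of Case II
is DRAWN) instead of `ℝ`-valued averages — plus the two probabilistic-method selections and the
counter. `exists_voters`, `exists_cover` and the numerical lemmas are generic.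

## Sources

* [Pich2024] J. Pich, *Localizability of the approximation method*, comput. complex. 33 (2024),
  arXiv:2212.09285: §2.1 Def. 1–4 and Prop. 1 (pp. 7–8), §3.1 Thm. 2, Lemma 1, Claim 3.1 with
  proofs (pp. 9–10) — held (`lit read arxiv:2212.09285`, arXiv page numbers).
* [Razborov1989] A. A. Razborov, *On the method of approximations*, STOC 1989, 167–176 — the
  original theorem, cited through [Pich2024] ("We present Razborov's proof", §3.1).
-/

noncomputable section

namespace Literature.Barriers.PneNP

open Finset Function

variable {n : ℕ}

namespace ApproximationMethod

variable (M : LegitimateModel n)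

/-! ### Error tuples -/

/-- The error set `δ_∘(f₁, f₂)` of an error tuple `⟨∘̄, f₁, f₂⟩` (`Covers` lists tuples, not sets).
[cite: Pich2024, §2.1 Def. 3–4 (p. 7)] -/
abbrev tupleErr (τ : LegitimateModel.ErrTuple n) : Finset (Fin n → Bool) := M.errSet τ.1 τ.2.1 τ.2.2

/-- Off its error set an approximating gate is exact. [cite: Pich2024, §2.1 Def. 3 (p. 7)] -/
theorem approx_apply_of_not_mem {c : Conn} {u w : (Fin n → Bool) → Bool} {x : Fin n → Bool}
    (h : x ∉ M.errSet c u w) : M.approx c u w x = c.apply (u x) (w x) := by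
  rw [mem_errSet_iff, not_not] at h
  exact h.symm

/-! ### Error tuples of the trivial circuits `C_h` (on `trivApprox`), and Claim 3.1 along a path -/

/-- The three error TUPLES at the top level of `C_h` (tuple form of `errAt`): the `∨` gate
(`none`) and the two `∧` gates (`some b`). [cite: Pich2024, §3.1 Claim 3.1 (p. 10)] -/
def rootTuple (k : ℕ) (w : Fin (k + 1) → Fin n) (h : TruthTable (k + 1)) :
    Option Bool → LegitimateModel.ErrTuple n
  | none => (.or, andApx M k w h true, andApx M k w h false)
  | some b => (.and, trivApprox M k (w ∘ Fin.succ) (h.half b), lit b (w 0))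

/-- Bridge to `errAt`: the error set of a root tuple is the level error set. [cite: Pich2024, §3.1, proof of Lemma 1 (pp. 9–10)] -/
theorem tupleErr_rootTuple (k : ℕ) (w : Fin (k + 1) → Fin n) (h : TruthTable (k + 1))
    (t : Option Bool) : tupleErr M (rootTuple M k w h t) = errAt M k w h t := by
  cases t <;> rfl

/-- A harmless default tuple `⟨∨̄, 0, 0⟩` (returned by `pathTuple` off range; components in `𝓜`). [folklore] -/
def defaultTuple : LegitimateModel.ErrTuple n := (.or, fun _ => false, fun _ => false)

/-- **The `3k` positions of Claim 3.1**: the root tuples of the node at depth `d` on the path of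
`C_h` consistent with `x` (`t` selects the gate). [cite: Pich2024, §3.1 Claim 3.1 (p. 10: "2n positions on the path consistent with x and n positions deviating from the path")] -/
def pathTuple : (k : ℕ) → (Fin k → Fin n) → TruthTable k → (Fin n → Bool) → ℕ → Option Bool →
    LegitimateModel.ErrTuple n
  | 0, _, _, _, _, _ => defaultTuple
  | k + 1, w, h, _, 0, t => rootTuple M k w h t
  | k + 1, w, h, x, d + 1, t => pathTuple k (w ∘ Fin.succ) (h.half (x (w 0))) x d t

/-- Components of root tuples lie in `𝓜`. [cite: Pich2024, §2.1 Def. 1–2 (p. 7)] -/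
theorem rootTuple_mem (k : ℕ) (w : Fin (k + 1) → Fin n) (h : TruthTable (k + 1)) (t : Option Bool) :
    (rootTuple M k w h t).2.1 ∈ M.carrier ∧ (rootTuple M k w h t).2.2 ∈ M.carrier := by
  cases t with
  | none => exact ⟨M.approx_mem _ _ _ (trivApprox_mem M _ _ _) (lit_mem M _ _),
      M.approx_mem _ _ _ (trivApprox_mem M _ _ _) (lit_mem M _ _)⟩
  | some b => exact ⟨trivApprox_mem M _ _ _, lit_mem M _ _⟩

/-- Components of path tuples lie in `𝓜`. [cite: Pich2024, §2.1 Def. 1–2 (p. 7)] -/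
theorem pathTuple_mem : ∀ (k : ℕ) (w : Fin k → Fin n) (h : TruthTable k) (x : Fin n → Bool)
    (d : ℕ) (t : Option Bool),
    (pathTuple M k w h x d t).2.1 ∈ M.carrier ∧ (pathTuple M k w h x d t).2.2 ∈ M.carrier
  | 0, _, _, _, _, _ => ⟨M.const_mem false, M.const_mem false⟩
  | k + 1, w, h, _, 0, t => rootTuple_mem M k w h t
  | k + 1, _, _, x, d + 1, t => pathTuple_mem k _ _ x d t

/-- **Claim 3.1 along the consistent path** (iterating `trivApprox_succ_ne`): if `x` lies in none
of the `3k` error sets on its path, then `C̄_h(x) = h(x)`.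
[cite: Pich2024, §3.1 Claim 3.1 with proof (p. 10)] -/
theorem trivApprox_apply_of_forall_not_mem : ∀ (k : ℕ) (w : Fin k → Fin n) (h : TruthTable k)
    (x : Fin n → Bool), (∀ d < k, ∀ t, x ∉ tupleErr M (pathTuple M k w h x d t)) →
      trivApprox M k w h x = TruthTable.eval k h (x ∘ w)
  | 0, _, _, _, _ => rfl
  | k + 1, w, h, x, hav => by
    by_contra hne
    rcases trivApprox_succ_ne M w h x hne with ⟨t, ht⟩ | hchild
    · refine hav 0 (Nat.succ_pos k) t ?_
      show x ∈ tupleErr M (rootTuple M k w h t)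
      rw [tupleErr_rootTuple]
      exact ht
    · exact hchild (trivApprox_apply_of_forall_not_mem k _ _ x fun d hd t =>
        hav (d + 1) (Nat.succ_lt_succ hd) t)

/-! ### Uniformity: the depth-`d` tuple has the same distribution on every path -/

/-- **Each half of a uniformly random table is uniformly random**, counting form:
`Σ_h Φ(hᵇ) = |TruthTable k| · Σ_p Φ(p)`. [cite: Pich2024, §3.1, proof of Lemma 1 (p. 10: Pr[x ∈ 𝛅 ∣ T(𝛅) = k] = Pr_{g_m ∈ F_m}[x ∈ δ¹])] -/
theorem sum_half (k : ℕ) (b : Bool) (Φ : TruthTable k → ℕ) :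
    ∑ h : TruthTable (k + 1), Φ (h.half b) = Fintype.card (TruthTable k) * ∑ p, Φ p := by
  have h := TruthTable.sum_succ k fun h => (Φ (h.half b) : ℝ)
  cases b
  · simp only [TruthTable.half_node_false, sum_const, card_univ, nsmul_eq_mul] at h
    exact_mod_cast h
  · simp only [TruthTable.half_node_true, sum_const, card_univ, nsmul_eq_mul] at h
    rw [← mul_sum] at h
    exact_mod_cast h

/-- **The position distributions do not depend on the path**: summed over all tables `h`, any
statistic of the depth-`d` tuple on the path of `x` equals the same statistic on the path of `y`.
[cite: Pich2024, §3.1, proof of Lemma 1 (p. 10)] -/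
theorem sum_pathTuple_eq (ψ : LegitimateModel.ErrTuple n → ℕ) : ∀ (k : ℕ) (w : Fin k → Fin n)
    (x y : Fin n → Bool) (d : ℕ) (t : Option Bool),
    ∑ h : TruthTable k, ψ (pathTuple M k w h x d t) = ∑ h : TruthTable k, ψ (pathTuple M k w h y d t)
  | 0, _, _, _, _, _ => rfl
  | _ + 1, _, _, _, 0, _ => rfl
  | k + 1, w, x, y, d + 1, t => by
    show ∑ h : TruthTable (k + 1), ψ (pathTuple M k (w ∘ Fin.succ) (h.half (x (w 0))) x d t) =
      ∑ h : TruthTable (k + 1), ψ (pathTuple M k (w ∘ Fin.succ) (h.half (y (w 0))) y d t)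
    rw [sum_half k (x (w 0)) (fun p => ψ (pathTuple M k (w ∘ Fin.succ) p x d t)),
      sum_half k (y (w 0)) (fun p => ψ (pathTuple M k (w ∘ Fin.succ) p y d t)),
      sum_pathTuple_eq ψ k (w ∘ Fin.succ) x y d t]

/-! ### All tuples of `C_h` (the trivial bound `ρ ≤ 3·2^k − 3`) -/

/-- All `3(2^k − 1)` error tuples of `C_h`. [cite: Pich2024, §2.1 Prop. 1 (p. 8) and §3.1 (p. 9: "ρ(f,𝓜) ≤ 2^{n₀}")] -/
def allTuples : (k : ℕ) → (Fin k → Fin n) → TruthTable k → List (LegitimateModel.ErrTuple n)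
  | 0, _, _ => []
  | k + 1, w, h =>
      [rootTuple M k w h none, rootTuple M k w h (some true), rootTuple M k w h (some false)] ++
        (allTuples k (w ∘ Fin.succ) (h.half true) ++ allTuples k (w ∘ Fin.succ) (h.half false))

/-- `|allTuples| + 3 = 3 · 2^k`. [folklore] -/
theorem length_allTuples_add : ∀ (k : ℕ) (w : Fin k → Fin n) (h : TruthTable k),
    (allTuples M k w h).length + 3 = 3 * 2 ^ k
  | 0, _, _ => rfl
  | k + 1, w, h => by
    have h1 := length_allTuples_add k (w ∘ Fin.succ) (h.half true)
    have h2 := length_allTuples_add k (w ∘ Fin.succ) (h.half false)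
    simp only [allTuples, List.length_append, List.length_cons, List.length_nil, pow_succ]
    omega

/-- Components of all tuples lie in `𝓜`. [cite: Pich2024, §2.1 Def. 1–2 (p. 7)] -/
theorem allTuples_mem : ∀ (k : ℕ) (w : Fin k → Fin n) (h : TruthTable k),
    ∀ τ ∈ allTuples M k w h, τ.2.1 ∈ M.carrier ∧ τ.2.2 ∈ M.carrier
  | 0, _, _, τ, hτ => by simp [allTuples] at hτ
  | k + 1, w, h, τ, hτ => by
    simp only [allTuples, List.mem_append, List.mem_cons, List.not_mem_nil, or_false] at hτ
    rcases hτ with (rfl | rfl | rfl) | hτ | hτ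
    · exact rootTuple_mem M k w h none
    · exact rootTuple_mem M k w h (some true)
    · exact rootTuple_mem M k w h (some false)
    · exact allTuples_mem k _ _ τ hτ
    · exact allTuples_mem k _ _ τ hτ

/-- Path tuples are tuples of the tree. [folklore] -/
theorem pathTuple_mem_allTuples : ∀ (k : ℕ) (w : Fin k → Fin n) (h : TruthTable k)
    (x : Fin n → Bool) (d : ℕ) (t : Option Bool), d < k → pathTuple M k w h x d t ∈ allTuples M k w h
  | 0, _, _, _, _, _, hd => (Nat.not_lt_zero _ hd).elim
  | k + 1, w, h, x, 0, t, _ => by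
    cases t with
    | none => simp [pathTuple, allTuples]
    | some b => cases b <;> simp [pathTuple, allTuples]
  | k + 1, w, h, x, d + 1, t, hd => by
    have ih := pathTuple_mem_allTuples k (w ∘ Fin.succ) (h.half (x (w 0))) x d t
      (Nat.lt_of_succ_lt_succ hd)
    simp only [pathTuple, allTuples, List.mem_append, List.mem_cons]
    revert ih
    cases x (w 0) <;> intro ih
    · exact Or.inr (Or.inr ih)
    · exact Or.inr (Or.inl ih)

/-- **`ρ(h ∘ w, 𝓜) ≤ 3·2^k − 3`**: the whole tree `C̄_h` covers `h ⊕ C̄_h`.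
[cite: Pich2024, §3.1 (p. 9: "otherwise ρ(f,𝓜) ≤ 2^{n₀} ≤ n") and §2.1 Prop. 1 (p. 8)] -/
theorem covers_eval_allTuples (k : ℕ) (w : Fin k → Fin n) (h : TruthTable k) :
    M.Covers (fun x => TruthTable.eval k h (x ∘ w)) (3 * 2 ^ k - 3) := by
  refine ⟨trivApprox M k w h, trivApprox_mem M k w h, allTuples M k w h, ?_, allTuples_mem M k w h,
    fun x hx => ?_⟩
  · have := length_allTuples_add M k w h; omega
  · by_contra hno
    exact hx (trivApprox_apply_of_forall_not_mem M k w h x fun d hd t hmem =>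
      hno ⟨_, pathTuple_mem_allTuples M k w h x d t hd, hmem⟩).symm

/-! ### The random approximator `𝐡 = D̄_𝐠` (on `topApprox`) and the random error set `𝛅` as a finite family -/

section Top

variable {N : ℕ} (σ : Fin N → Fin n) (τ z : TruthTable N)

/-- The three top error TUPLES of `D_g` (tuple form of `topErr`). [cite: Pich2024, §3.1 Claim 3.1 (p. 10: "the error can occur either in one of the top 3 gates of D_g or …")] -/
def topTuple (g : TruthTable N) : Option Bool → LegitimateModel.ErrTuple n
  | none => (.or,
      M.approx .and (trivApprox M N σ (child τ z true false g)) (trivApprox M N σ (child τ z false true g)),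
      M.approx .and (trivApprox M N σ (child τ z true true g)) (trivApprox M N σ (child τ z false false g)))
  | some b => (.and, trivApprox M N σ (child τ z true (!b) g), trivApprox M N σ (child τ z false b g))

/-- Bridge to `topErr`. [cite: Pich2024, §3.1, proof of Lemma 1 (pp. 9–10)] -/
theorem tupleErr_topTuple (g : TruthTable N) (t : Option Bool) :
    tupleErr M (topTuple M σ τ z g t) = topErr M σ τ z g t := by
  cases t <;> rfl

/-- Components of the top tuples lie in `𝓜`. [cite: Pich2024, §2.1 Def. 1–2 (p. 7)] -/
theorem topTuple_mem (g : TruthTable N) (t : Option Bool) :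
    (topTuple M σ τ z g t).2.1 ∈ M.carrier ∧ (topTuple M σ τ z g t).2.2 ∈ M.carrier := by
  rcases t with _ | b
  · exact ⟨M.approx_mem _ _ _ (trivApprox_mem M _ _ _) (trivApprox_mem M _ _ _),
      M.approx_mem _ _ _ (trivApprox_mem M _ _ _) (trivApprox_mem M _ _ _)⟩
  · exact ⟨trivApprox_mem M _ _ _, trivApprox_mem M _ _ _⟩

/-- **Claim 3.1 for `D_g`, tuple form**: if `D̄_g(x) ≠ f(x)` then `x` lies in one of the `3` top
error sets or in one of the `3N` error sets on the path of `x` in one of the four sub-trees.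
[cite: Pich2024, §3.1 Claim 3.1 (p. 10: "3 + 12n positions")] -/
theorem exists_mem_of_topApprox_ne (hz : ∀ y, TruthTable.eval N z y = false) (g : TruthTable N)
    (x : Fin n → Bool) (hne : topApprox M σ τ z g x ≠ TruthTable.eval N τ (x ∘ σ)) :
    (∃ t, x ∈ tupleErr M (topTuple M σ τ z g t)) ∨
      ∃ ab : Bool × Bool, ∃ d < N, ∃ t,
        x ∈ tupleErr M (pathTuple M N σ (child τ z ab.1 ab.2 g) x d t) := by
  rcases topApprox_ne M σ τ z hz g x hne with ⟨t, ht⟩ | ⟨ab, hab⟩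
  · exact Or.inl ⟨t, by rw [tupleErr_topTuple]; exact ht⟩
  · right
    refine ⟨ab, ?_⟩
    by_contra hno
    simp only [not_exists, not_and] at hno
    exact hab (trivApprox_apply_of_forall_not_mem M N σ _ x fun d hd t => hno d hd t)

/-- **The sample space of the random error set `𝛅`**: a uniformly random table `g` together
with a uniformly random TYPE — a top gate, or a (depth, gate) position — the positional tuple
being read off the all-`0` path (every path carries the same distribution, `sum_pathTuple_eq`);
`|Space N| = 3(N+1)·|F_N|`. [cite: Pich2024, §3.1, proof of Lemma 1 (p. 10: definition of 𝛅 by the 3(n+1) types ⟨m, t⟩)] -/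
abbrev Space (N : ℕ) : Type := TruthTable N × (Option Bool ⊕ Fin N × Option Bool)

/-- The error tuple `𝛅(ω)` of a sample point. [cite: Pich2024, §3.1, proof of Lemma 1 (p. 10)] -/
def fam : Space N → LegitimateModel.ErrTuple n
  | (g, Sum.inl t) => topTuple M σ τ z g t
  | (g, Sum.inr p) => pathTuple M N σ g (fun _ => false) p.1 p.2

/-- Components of every `𝛅(ω)` lie in `𝓜` (so `𝛅(ω) ∈ Δ`). [cite: Pich2024, §2.1 Def. 3 (p. 7)] -/
theorem fam_mem (ω : Space N) : (fam M σ τ z ω).2.1 ∈ M.carrier ∧ (fam M σ τ z ω).2.2 ∈ M.carrier := by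
  rcases ω with ⟨g, t | p⟩
  · exact topTuple_mem M σ τ z g t
  · exact pathTuple_mem M N σ g _ p.1 p.2

/-- `|Space N| = |F_N| · 3(N+1)` (the `3(n+1)` types). [cite: Pich2024, §3.1, proof of Lemma 1 (p. 10: "there are 3(n+1) possible types")] -/
theorem card_space (N : ℕ) :
    Fintype.card (Space N) = Fintype.card (TruthTable N) * (3 * (N + 1)) := by
  simp only [Fintype.card_prod, Fintype.card_sum, Fintype.card_option, Fintype.card_bool,
    Fintype.card_fin]
  ring

/-- `W_x := #{g : D̄_g(x) ≠ f(x)}` (`|F_N| · Pr[𝐡(x) ≠ f(x)]`). [cite: Pich2024, §3.1 Lemma 1 (p. 9)] -/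
def badCount (x : Fin n → Bool) : ℕ :=
  (univ.filter fun g : TruthTable N => topApprox M σ τ z g x ≠ TruthTable.eval N τ (x ∘ σ)).card

/-- `cnt_x := #{ω : x ∈ 𝛅(ω)}` (`|Space N| · Pr[x ∈ 𝛅]`). [cite: Pich2024, §3.1 Lemma 1 (p. 9)] -/
def hitCount (x : Fin n → Bool) : ℕ :=
  (univ.filter fun ω : Space N => x ∈ tupleErr M (fam M σ τ z ω)).card

/-- **Lemma 1 (Pich 2024 / Razborov 1989), counting form: `Pr[𝐡(x) ≠ f(x)] ≤ 12(N+1)·Pr[x ∈ 𝛅]`**,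
i.e. `W_x ≤ 4 · cnt_x` with `|Space N| = 3(N+1)|F_N|` (union bound over the positions of Claim 3.1,
the four sub-tables uniformly random, every path equidistributed).
[cite: Pich2024, §3.1 Lemma 1 with proof (pp. 9–10)] -/
theorem badCount_le (hz : ∀ y, TruthTable.eval N z y = false) (x : Fin n → Bool) :
    badCount M σ τ z x ≤ 4 * hitCount M σ τ z x := by
  classical
  set top : TruthTable N → ℕ := fun g =>
    ∑ t : Option Bool, if x ∈ tupleErr M (topTuple M σ τ z g t) then 1 else 0 with htop
  set pth : TruthTable N → (Fin n → Bool) → ℕ := fun g y =>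
    ∑ p : Fin N × Option Bool, if x ∈ tupleErr M (pathTuple M N σ g y p.1 p.2) then 1 else 0
    with hpth
  -- (1) pointwise: Claim 3.1
  have h1 : badCount M σ τ z x ≤ ∑ g, (top g + ∑ ab : Bool × Bool, pth (child τ z ab.1 ab.2 g) x) := by
    unfold badCount
    rw [card_filter]
    refine sum_le_sum fun g _ => ?_
    split_ifs with hbad
    · rcases exists_mem_of_topApprox_ne M σ τ z hz g x hbad with ⟨t, ht⟩ | ⟨ab, d, hd, t, ht⟩
      · have : 1 ≤ top g := by
          rw [htop]
          refine le_trans ?_ (single_le_sum (f := fun t : Option Bool =>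
            if x ∈ tupleErr M (topTuple M σ τ z g t) then 1 else 0) (fun _ _ => Nat.zero_le _)
            (mem_univ t))
          simp [ht]
        omega
      · have h' : 1 ≤ pth (child τ z ab.1 ab.2 g) x := by
          rw [hpth]
          refine le_trans ?_ (single_le_sum (f := fun p : Fin N × Option Bool =>
            if x ∈ tupleErr M (pathTuple M N σ (child τ z ab.1 ab.2 g) x p.1 p.2) then 1 else 0)
            (fun _ _ => Nat.zero_le _) (mem_univ (⟨d, hd⟩, t)))
          simp [ht]
        have : pth (child τ z ab.1 ab.2 g) x ≤ ∑ ab : Bool × Bool, pth (child τ z ab.1 ab.2 g) x :=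
          single_le_sum (f := fun ab : Bool × Bool => pth (child τ z ab.1 ab.2 g) x)
            (fun _ _ => Nat.zero_le _) (mem_univ ab)
        omega
    · exact Nat.zero_le _
  -- (2) each `g ↦ child a b g` is a bijection
  have h2 : ∀ ab : Bool × Bool, ∑ g, pth (child τ z ab.1 ab.2 g) x = ∑ g, pth g x := fun ab =>
    Equiv.sum_comp (child_involutive τ z ab.1 ab.2).toPerm (fun g => pth g x)
  -- (3) the path of `x` and the all-`0` path carry the same distribution
  have h3 : ∑ g, pth g x = ∑ g, pth g (fun _ => false) := by
    simp only [hpth]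
    calc ∑ g, ∑ p : Fin N × Option Bool,
          (if x ∈ tupleErr M (pathTuple M N σ g x p.1 p.2) then 1 else 0)
        = ∑ p : Fin N × Option Bool, ∑ g : TruthTable N,
            (if x ∈ tupleErr M (pathTuple M N σ g x p.1 p.2) then 1 else 0) := sum_comm
      _ = ∑ p : Fin N × Option Bool, ∑ g : TruthTable N,
            (if x ∈ tupleErr M (pathTuple M N σ g (fun _ => false) p.1 p.2) then 1 else 0) :=
          sum_congr rfl fun p _ =>
            sum_pathTuple_eq M (fun τ' => if x ∈ tupleErr M τ' then 1 else 0) N σ x _ p.1 p.2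
      _ = _ := sum_comm
  -- (4) the hit count splits by type
  have h4 : hitCount M σ τ z x = ∑ g, (top g + pth g (fun _ => false)) := by
    unfold hitCount
    rw [card_filter, Fintype.sum_prod_type]
    refine sum_congr rfl fun g _ => ?_
    rw [Fintype.sum_sum_type]
    rfl
  rw [h4]
  calc badCount M σ τ z x ≤ ∑ g, (top g + ∑ ab : Bool × Bool, pth (child τ z ab.1 ab.2 g) x) := h1
    _ = ∑ g, top g + ∑ ab : Bool × Bool, ∑ g, pth (child τ z ab.1 ab.2 g) x := by
      rw [sum_add_distrib]; congr 1; exact sum_comm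
    _ = ∑ g, top g + 4 * ∑ g, pth g (fun _ => false) := by
      simp only [h2, h3, sum_const, card_univ, Fintype.card_prod, Fintype.card_bool, smul_eq_mul]
    _ ≤ 4 * ∑ g, (top g + pth g (fun _ => false)) := by rw [sum_add_distrib]; omega

end Top

/-! ### Exact little-endian binary counters -/

/-- Ripple-carry increment of a little-endian bit list by a carry bit (overflow dropped). [folklore] -/
def incBits : List Bool → Bool → List Bool
  | [], _ => []
  | b :: bs, c => xor b c :: incBits bs (b && c)

/-- The number with the given little-endian bits. [folklore] -/
def ofBits : List Bool → ℕ
  | [] => 0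
  | b :: bs => b.toNat + 2 * ofBits bs

/-- `incBits` preserves the length. [folklore] -/
@[simp] theorem length_incBits : ∀ (bs : List Bool) (c : Bool), (incBits bs c).length = bs.length
  | [], _ => rfl
  | b :: bs, c => by simp [incBits, length_incBits bs]

/-- `ofBits bs < 2^|bs|`. [folklore] -/
theorem ofBits_lt : ∀ bs : List Bool, ofBits bs < 2 ^ bs.length
  | [] => by simp [ofBits]
  | b :: bs => by
    have := ofBits_lt bs
    simp only [ofBits, List.length_cons, pow_succ]
    cases b <;> simp <;> omega

/-- Without overflow the incrementer adds the carry. [folklore] -/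
theorem ofBits_incBits : ∀ (bs : List Bool) (c : Bool), ofBits bs + c.toNat < 2 ^ bs.length →
    ofBits (incBits bs c) = ofBits bs + c.toNat
  | [], c, h => by cases c <;> simp_all [ofBits, incBits]
  | b :: bs, c, h => by
    simp only [ofBits, List.length_cons, pow_succ] at h
    have ih := ofBits_incBits bs (b && c)
    simp only [incBits, ofBits]
    cases b <;> cases c <;> simp_all <;> omega

/-- The all-zero register. [folklore] -/
@[simp] theorem ofBits_replicate_false : ∀ L : ℕ, ofBits (List.replicate L false) = 0
  | 0 => rfl
  | L + 1 => by simp [List.replicate_succ, ofBits, ofBits_replicate_false L]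

/-- Counting a list of bits into a register: the value is the number of ones (no overflow). [folklore] -/
theorem ofBits_foldl_incBits : ∀ (as : List Bool) (ws : List Bool),
    ofBits ws + (as.map Bool.toNat).sum < 2 ^ ws.length →
      ofBits (as.foldl incBits ws) = ofBits ws + (as.map Bool.toNat).sum ∧
        (as.foldl incBits ws).length = ws.length
  | [], ws, _ => by simp
  | a :: as, ws, h => by
    simp only [List.map_cons, List.sum_cons] at h
    have h1 : ofBits ws + a.toNat < 2 ^ ws.length := by omega
    have h2 := ofBits_incBits ws a h1
    have ih := ofBits_foldl_incBits as (incBits ws a) (by rw [h2, length_incBits]; omega)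
    simp only [List.foldl_cons, List.map_cons, List.sum_cons]
    rw [ih.1, ih.2, h2, length_incBits]
    exact ⟨by ring, rfl⟩

/-- **The top bit is the threshold `[2^{L-1} ≤ value]`.** [folklore] -/
theorem getLast_eq_decide : ∀ (bs : List Bool) (h : bs ≠ []),
    bs.getLast h = decide (2 ^ (bs.length - 1) ≤ ofBits bs)
  | [], h => (h rfl).elim
  | [b], _ => by cases b <;> simp [ofBits]
  | b :: b' :: bs, _ => by
    have ih := getLast_eq_decide (b' :: bs) (List.cons_ne_nil _ _)
    rw [List.getLast_cons (List.cons_ne_nil _ _), ih]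
    have hlt := ofBits_lt (b' :: bs)
    simp only [List.length_cons, Nat.add_sub_cancel, ofBits] at hlt ⊢
    have h2 : 2 ^ (bs.length + 1) = 2 * 2 ^ bs.length := by rw [pow_succ]; ring
    rw [h2]
    cases b <;> simp only [Bool.toNat_false, Bool.toNat_true] <;>
      · by_cases hc : 2 ^ bs.length ≤ b'.toNat + 2 * ofBits bs
        · rw [decide_eq_true hc, decide_eq_true (by omega)]
        · rw [decide_eq_false hc, decide_eq_false (by omega)]

/-! ### The counter inside `𝓜` -/

/-- One ripple-carry increment of the register `ws` by the input wire `a`, computed in `𝓜`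
(`s = (w ∨̄ a) ∧̄ ¬(w ∧̄ a)`, carry `w ∧̄ a`), together with the error tuples of its
`3 · |ws|` binary gates. [cite: Pich2024, §3.1, proof of Thm. 2, Case I (p. 9: "MAJ on m inputs is computable by an O(m log m)-size circuit M, we set g := M̄(h_1,…)")] -/
def incApx : ((Fin n → Bool) → Bool) → List ((Fin n → Bool) → Bool) →
    List ((Fin n → Bool) → Bool) × List (LegitimateModel.ErrTuple n)
  | _, [] => ([], [])
  | a, w :: ws =>
      let o := M.approx .or w a
      let c := M.approx .and w a
      let r := incApx c ws
      (M.approx .and o (fun x => !c x) :: r.1, (.or, w, a) :: (.and, w, a) :: (.and, o, fun x => !c x) :: r.2)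

/-- The incrementer keeps the register length. [folklore] -/
theorem length_incApx_fst : ∀ (a : (Fin n → Bool) → Bool) (ws : List ((Fin n → Bool) → Bool)),
    (incApx M a ws).1.length = ws.length
  | _, [] => rfl
  | a, w :: ws => by simp [incApx, length_incApx_fst _ ws]

/-- The incrementer emits `3|ws|` tuples. [folklore] -/
theorem length_incApx_snd : ∀ (a : (Fin n → Bool) → Bool) (ws : List ((Fin n → Bool) → Bool)),
    (incApx M a ws).2.length = 3 * ws.length
  | _, [] => rfl
  | a, w :: ws => by simp [incApx, length_incApx_snd _ ws]; ring

/-- Register wires stay in `𝓜`. [cite: Pich2024, §2.1 Def. 1 (p. 7)] -/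
theorem incApx_fst_mem : ∀ (a : (Fin n → Bool) → Bool) (ws : List ((Fin n → Bool) → Bool)),
    a ∈ M.carrier → (∀ w ∈ ws, w ∈ M.carrier) → ∀ w ∈ (incApx M a ws).1, w ∈ M.carrier
  | _, [], _, _, w, hw => by simp [incApx] at hw
  | a, w₀ :: ws, ha, hws, w, hw => by
    simp only [incApx, List.mem_cons] at hw
    have hw₀ : w₀ ∈ M.carrier := hws w₀ (by simp)
    have hc : M.approx .and w₀ a ∈ M.carrier := M.approx_mem _ _ _ hw₀ ha
    rcases hw with rfl | hw
    · exact M.approx_mem _ _ _ (M.approx_mem _ _ _ hw₀ ha) (M.compl_mem _ hc)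
    · exact incApx_fst_mem _ ws hc (fun w' hw' => hws w' (by simp [hw'])) w hw

/-- Tuple components stay in `𝓜`. [cite: Pich2024, §2.1 Def. 1 (p. 7)] -/
theorem incApx_snd_mem : ∀ (a : (Fin n → Bool) → Bool) (ws : List ((Fin n → Bool) → Bool)),
    a ∈ M.carrier → (∀ w ∈ ws, w ∈ M.carrier) →
      ∀ τ ∈ (incApx M a ws).2, τ.2.1 ∈ M.carrier ∧ τ.2.2 ∈ M.carrier
  | _, [], _, _, τ, hτ => by simp [incApx] at hτ
  | a, w₀ :: ws, ha, hws, τ, hτ => by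
    simp only [incApx, List.mem_cons] at hτ
    have hw₀ : w₀ ∈ M.carrier := hws w₀ (by simp)
    have hc : M.approx .and w₀ a ∈ M.carrier := M.approx_mem _ _ _ hw₀ ha
    rcases hτ with rfl | rfl | rfl | hτ
    · exact ⟨hw₀, ha⟩
    · exact ⟨hw₀, ha⟩
    · exact ⟨M.approx_mem _ _ _ hw₀ ha, M.compl_mem _ hc⟩
    · exact incApx_snd_mem _ ws hc (fun w' hw' => hws w' (by simp [hw'])) τ hτ

/-- **The incrementer is exact off its error sets.** [cite: Pich2024, §2.1 Prop. 1 (p. 8)] -/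
theorem map_incApx_fst : ∀ (a : (Fin n → Bool) → Bool) (ws : List ((Fin n → Bool) → Bool))
    (x : Fin n → Bool), (∀ τ ∈ (incApx M a ws).2, x ∉ M.errSet τ.1 τ.2.1 τ.2.2) →
      (incApx M a ws).1.map (fun w => w x) = incBits (ws.map fun w => w x) (a x)
  | _, [], _, _ => rfl
  | a, w :: ws, x, h => by
    simp only [incApx, List.mem_cons, forall_eq_or_imp] at h
    obtain ⟨h1, h2, h3, h4⟩ := h
    have ih := map_incApx_fst (M.approx .and w a) ws x h4
    have e1 := approx_apply_of_not_mem M h1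
    have e2 := approx_apply_of_not_mem M h2
    have e3 := approx_apply_of_not_mem M h3
    simp only [Conn.apply] at e1 e2 e3
    simp only [incApx, List.map_cons, incBits, ih]
    rw [e3, e1, e2]
    cases w x <;> cases a x <;> rfl

/-- The register after feeding the inputs `as` one by one. [cite: Pich2024, §3.1, proof of Thm. 2, Case I (p. 9)] -/
def counterWires : List ((Fin n → Bool) → Bool) → List ((Fin n → Bool) → Bool) →
    List ((Fin n → Bool) → Bool)
  | [], ws => ws
  | a :: as, ws => counterWires as (incApx M a ws).1

/-- The error tuples of the whole counter. [cite: Pich2024, §3.1, proof of Thm. 2, Case I (p. 9)] -/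
def counterTuples : List ((Fin n → Bool) → Bool) → List ((Fin n → Bool) → Bool) → List (LegitimateModel.ErrTuple n)
  | [], _ => []
  | a :: as, ws => (incApx M a ws).2 ++ counterTuples as (incApx M a ws).1

/-- The counter keeps the register length. [folklore] -/
theorem length_counterWires : ∀ (as ws : List ((Fin n → Bool) → Bool)),
    (counterWires M as ws).length = ws.length
  | [], _ => rfl
  | a :: as, ws => by rw [counterWires, length_counterWires as, length_incApx_fst]

/-- The counter has `3 · L · k` binary gates. [cite: Pich2024, §3.1, proof of Thm. 2, Case I (p. 9: "O(m log m)-size circuit")] -/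
theorem length_counterTuples : ∀ (as ws : List ((Fin n → Bool) → Bool)),
    (counterTuples M as ws).length = 3 * ws.length * as.length
  | [], _ => by simp [counterTuples]
  | a :: as, ws => by
    rw [counterTuples, List.length_append, length_counterTuples as, length_incApx_fst,
      length_incApx_snd, List.length_cons]
    ring

/-- Register wires of the counter lie in `𝓜`. [cite: Pich2024, §2.1 Def. 1 (p. 7)] -/
theorem counterWires_mem : ∀ (as ws : List ((Fin n → Bool) → Bool)), (∀ a ∈ as, a ∈ M.carrier) →
    (∀ w ∈ ws, w ∈ M.carrier) → ∀ w ∈ counterWires M as ws, w ∈ M.carrier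
  | [], _, _, hws => hws
  | a :: as, ws, has, hws => by
    rw [counterWires]
    exact counterWires_mem as _ (fun a' ha' => has a' (by simp [ha']))
      (incApx_fst_mem M a ws (has a (by simp)) hws)

/-- Tuple components of the counter lie in `𝓜`. [cite: Pich2024, §2.1 Def. 1 (p. 7)] -/
theorem counterTuples_mem : ∀ (as ws : List ((Fin n → Bool) → Bool)), (∀ a ∈ as, a ∈ M.carrier) →
    (∀ w ∈ ws, w ∈ M.carrier) → ∀ τ ∈ counterTuples M as ws, τ.2.1 ∈ M.carrier ∧ τ.2.2 ∈ M.carrier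
  | [], _, _, _, τ, hτ => by simp [counterTuples] at hτ
  | a :: as, ws, has, hws, τ, hτ => by
    rw [counterTuples, List.mem_append] at hτ
    rcases hτ with hτ | hτ
    · exact incApx_snd_mem M a ws (has a (by simp)) hws τ hτ
    · exact counterTuples_mem as _ (fun a' ha' => has a' (by simp [ha']))
        (incApx_fst_mem M a ws (has a (by simp)) hws) τ hτ

/-- **The counter is exact off its error sets**: the register holds the binary count.
[cite: Pich2024, §2.1 Prop. 1 (p. 8)] -/
theorem map_counterWires : ∀ (as ws : List ((Fin n → Bool) → Bool)) (x : Fin n → Bool),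
    (∀ τ ∈ counterTuples M as ws, x ∉ M.errSet τ.1 τ.2.1 τ.2.2) →
      (counterWires M as ws).map (fun w => w x) =
        (as.map fun a => a x).foldl incBits (ws.map fun w => w x)
  | [], _, _, _ => rfl
  | a :: as, ws, x, h => by
    simp only [counterTuples, List.mem_append] at h
    have h1 := map_incApx_fst M a ws x fun τ hτ => h τ (Or.inl hτ)
    have ih := map_counterWires as (incApx M a ws).1 x fun τ hτ => h τ (Or.inr hτ)
    rw [counterWires, ih, h1]
    rfl

/-- **The threshold device (Case I): a majority vote inside `𝓜` with `3·L·k` error tuples.**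
For `k = 2^L - 1` input wires `aᵢ ∈ 𝓜` there is `g ∈ 𝓜` — the top bit of a binary counter of
the `aᵢ` — such that at every `x` outside the device's error sets, if fewer than half of the
`aᵢ(x)` differ from `b` then `g(x) = b`. [cite: Pich2024, §3.1, proof of Thm. 2, Case I (p. 9)] -/
theorem exists_threshold_device (L k : ℕ) (hL : 1 ≤ L) (hk : k + 1 = 2 ^ L)
    (a : Fin k → (Fin n → Bool) → Bool) (ha : ∀ i, a i ∈ M.carrier) :
    ∃ g ∈ M.carrier, ∃ l : List (LegitimateModel.ErrTuple n), l.length = 3 * L * k ∧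
      (∀ τ ∈ l, τ.2.1 ∈ M.carrier ∧ τ.2.2 ∈ M.carrier) ∧
        ∀ (x : Fin n → Bool) (b : Bool), (∀ τ ∈ l, x ∉ M.errSet τ.1 τ.2.1 τ.2.2) →
          2 * (univ.filter fun i => a i x ≠ b).card < k → g x = b := by
  set ws₀ : List ((Fin n → Bool) → Bool) := List.replicate L fun _ => false with hws₀
  set as : List ((Fin n → Bool) → Bool) := List.ofFn a with has
  set W := counterWires M as ws₀ with hW
  have has_mem : ∀ a' ∈ as, a' ∈ M.carrier := by
    intro a' ha'
    rw [has, List.mem_ofFn] at ha'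
    obtain ⟨i, rfl⟩ := ha'
    exact ha i
  have hws₀_mem : ∀ w ∈ ws₀, w ∈ M.carrier := by
    intro w hw
    rw [hws₀, List.mem_replicate] at hw
    rw [hw.2]
    exact M.const_mem false
  have hWlen : W.length = L := by rw [hW, length_counterWires, hws₀, List.length_replicate]
  have hWne : W ≠ [] := by
    intro h; rw [h] at hWlen; simp at hWlen; omega
  refine ⟨W.getLast hWne, counterWires_mem M as ws₀ has_mem hws₀_mem _ (List.getLast_mem hWne),
    counterTuples M as ws₀, ?_, counterTuples_mem M as ws₀ has_mem hws₀_mem, ?_⟩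
  · rw [length_counterTuples, hws₀, List.length_replicate, has, List.length_ofFn]
  · intro x b havoid hlt
    -- the register at `x` holds the count
    have hmap := map_counterWires M as ws₀ x havoid
    have hx₀ : ws₀.map (fun w => w x) = List.replicate L false := by
      rw [hws₀, List.map_replicate]
    have hsum : ((as.map fun a' => a' x).map Bool.toNat).sum = ∑ i, (a i x).toNat := by
      rw [has, List.map_ofFn, List.map_ofFn, List.sum_ofFn]
      rfl
    have hVle : ∑ i, (a i x).toNat ≤ k := by
      calc ∑ i, (a i x).toNat ≤ ∑ _i : Fin k, 1 := sum_le_sum fun i _ => Bool.toNat_le _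
        _ = k := by simp
    obtain ⟨L', rfl⟩ : ∃ L', L = L' + 1 := ⟨L - 1, by omega⟩
    have hpow : 2 ^ (L' + 1) = 2 * 2 ^ L' := by rw [pow_succ]; ring
    have hval := ofBits_foldl_incBits (as.map fun a' => a' x) (ws₀.map fun w => w x)
      (by rw [hx₀, ofBits_replicate_false, List.length_replicate, hsum]; omega)
    rw [hx₀, ofBits_replicate_false, List.length_replicate, hsum, zero_add] at hval
    set B := (as.map fun a' => a' x).foldl incBits (List.replicate (L' + 1) false) with hB
    rw [hx₀] at hmap
    have hBne : B ≠ [] := by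
      intro h; have := hval.2; rw [h] at this; simp at this
    have htop := getLast_eq_decide B hBne
    rw [hval.2, hval.1, Nat.add_sub_cancel] at htop
    -- `g x` is the top bit
    have hgx : W.getLast hWne x = B.getLast hBne := by
      have h1 : (W.map fun w => w x).getLast? = some (W.getLast hWne x) := by
        rw [List.getLast?_map, List.getLast?_eq_some_getLast hWne]; rfl
      rw [hmap, List.getLast?_eq_some_getLast hBne] at h1
      exact (Option.some.inj h1).symm
    rw [hgx, htop]
    -- counting
    have hcount : ∀ c : Bool, (univ.filter fun i => a i x ≠ c).card =
        ∑ i, (if a i x ≠ c then 1 else 0) := fun c => card_filter _ _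
    cases b
    · -- `b = false`: the count equals the number of disagreements
      have hV : ∑ i, (a i x).toNat = (univ.filter fun i => a i x ≠ false).card := by
        rw [hcount]
        refine sum_congr rfl fun i _ => ?_
        cases a i x <;> simp
      rw [hV] at *
      exact decide_eq_false (by omega)
    · -- `b = true`: count + disagreements = k
      have hV : ∑ i, (a i x).toNat + (univ.filter fun i => a i x ≠ true).card = k := by
        rw [hcount, ← sum_add_distrib]
        calc ∑ i, ((a i x).toNat + if a i x ≠ true then 1 else 0) = ∑ _i : Fin k, 1 :=
              sum_congr rfl fun i _ => by cases a i x <;> simp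
          _ = k := by simp
      exact decide_eq_true (by omega)


/-! ### Numerical facts -/

/-- `4·16¹² < 18¹²` scaled: `4ⁿ · 16ᵏ < 18ᵏ` for `k ≥ 12 n`, `n ≥ 1`. [folklore] -/
theorem four_pow_mul_sixteen_pow_lt (n k : ℕ) (hn : 1 ≤ n) (hk : 12 * n ≤ k) :
    4 ^ n * 16 ^ k < 18 ^ k := by
  obtain ⟨r, rfl⟩ : ∃ r, k = 12 * n + r := ⟨k - 12 * n, by omega⟩
  have h1 : 4 ^ n * 16 ^ (12 * n) < 18 ^ (12 * n) := by
    rw [pow_mul, pow_mul, ← mul_pow]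
    exact Nat.pow_lt_pow_left (by norm_num) (by omega)
  calc 4 ^ n * 16 ^ (12 * n + r) = 4 ^ n * 16 ^ (12 * n) * 16 ^ r := by rw [pow_add]; ring
    _ < 18 ^ (12 * n) * 16 ^ r := Nat.mul_lt_mul_of_pos_right h1 (by positivity)
    _ ≤ 18 ^ (12 * n) * 18 ^ r := Nat.mul_le_mul_left _ (Nat.pow_le_pow_left (by norm_num) r)
    _ = 18 ^ (12 * n + r) := by rw [pow_add]

/-- `2 (K-1)^K < K^K` for `K ≥ 2` (from `(1 + 1/(K-1))^K ≥ 1 + K/(K-1) > 2`). [folklore] -/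
theorem two_mul_pow_lt_pow (K : ℕ) (hK : 2 ≤ K) : 2 * (K - 1) ^ K < K ^ K := by
  obtain ⟨J, rfl⟩ : ∃ J, K = J + 1 := ⟨K - 1, by omega⟩
  simp only [Nat.add_sub_cancel]
  -- Bernoulli: `J^j (J + j) ≤ (J+1)^j J`
  have key : ∀ j : ℕ, J ^ j * (J + j) ≤ (J + 1) ^ j * J := by
    intro j
    induction j with
    | zero => simp
    | succ j ih =>
      calc J ^ (j + 1) * (J + (j + 1)) = J ^ j * (J * (J + j + 1)) := by ring
        _ ≤ J ^ j * ((J + j) * (J + 1)) := Nat.mul_le_mul_left _ (by nlinarith)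
        _ = J ^ j * (J + j) * (J + 1) := by ring
        _ ≤ (J + 1) ^ j * J * (J + 1) := Nat.mul_le_mul_right _ ih
        _ = (J + 1) ^ (j + 1) * J := by ring
  have hJ : 1 ≤ J := by omega
  have h1 := key (J + 1)
  have hpos : 0 < J ^ (J + 1) := by positivity
  -- `2 J^{J+1} · J = J^{J+1} (2J) < J^{J+1} (2J+1) ≤ (J+1)^{J+1} J`
  have h2 : 2 * J ^ (J + 1) * J < (J + 1) ^ (J + 1) * J := by
    calc 2 * J ^ (J + 1) * J < J ^ (J + 1) * (J + (J + 1)) := by nlinarith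
      _ ≤ (J + 1) ^ (J + 1) * J := h1
  exact Nat.lt_of_mul_lt_mul_right h2

/-! ### Case I: derandomised Chernoff by the exponential moment -/

/-- **Case I selection.** For a finite family of "votes" `bad g x`, there are `k ≥ 12 n`
voters `g₁, …, g_k` such that at every `x ∈ {0,1}ⁿ` where fewer than a third of all `g` are bad,
fewer than half of the chosen ones are: `Σ_{g⃗} Σ_x 2^{#bad} = Σ_x (|G| + W_x)^k ≤ 2ⁿ (4/3)^k |G|^k
< 2^{k/2} |G|^k`. [cite: Pich2024, §3.1, proof of Thm. 2, Case I (p. 9: "By Chernoff's bound … we can fix h_1, …, h_{O(n)} such that MAJ … coincides with f on all such inputs")] -/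
theorem exists_voters {G : Type*} [Fintype G] [Nonempty G] (n k : ℕ) (hn : 1 ≤ n) (hk : 12 * n ≤ k)
    (bad : G → (Fin n → Bool) → Prop) [∀ g x, Decidable (bad g x)] :
    ∃ gs : Fin k → G, ∀ x : Fin n → Bool,
      3 * (univ.filter fun g => bad g x).card < Fintype.card G →
        2 * (univ.filter fun i => bad (gs i) x).card < k := by
  classical
  set W : (Fin n → Bool) → ℕ := fun x => (univ.filter fun g => bad g x).card with hW
  set C₁ : Finset (Fin n → Bool) := univ.filter fun x => 3 * W x < Fintype.card G with hC₁
  set wr : (Fin k → G) → (Fin n → Bool) → ℕ := fun gs x => (univ.filter fun i => bad (gs i) x).card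
    with hwr
  set Φ : (Fin k → G) → ℕ := fun gs => ∑ x ∈ C₁, 2 ^ wr gs x with hΦ
  -- the exponential moment, per `x`
  have hmoment : ∀ x, ∑ gs : Fin k → G, 2 ^ wr gs x = (Fintype.card G + W x) ^ k := by
    intro x
    have h2 : ∀ gs : Fin k → G, 2 ^ wr gs x = ∏ i, (if bad (gs i) x then 2 else 1) := by
      intro gs
      rw [prod_ite, prod_const, prod_const_one, mul_one]
    simp_rw [h2]
    rw [← Fintype.prod_sum fun (_ : Fin k) (g : G) => if bad g x then 2 else 1]
    rw [prod_const, card_univ, Fintype.card_fin]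
    congr 1
    rw [hW]
    simp only
    rw [card_filter, ← card_univ, card_eq_sum_ones, ← sum_add_distrib]
    exact sum_congr rfl fun g _ => by split_ifs <;> rfl
  -- summed: `3^k Σ Φ ≤ |G^k| · 2^n 4^k`
  have hsum : ∑ gs : Fin k → G, 3 ^ k * Φ gs ≤
      ∑ _gs : Fin k → G, 2 ^ n * 4 ^ k := by
    rw [← mul_sum, hΦ]
    simp only
    rw [sum_comm]
    simp_rw [hmoment]
    rw [sum_const, card_univ, smul_eq_mul, Fintype.card_fun, Fintype.card_fin]
    calc 3 ^ k * ∑ x ∈ C₁, (Fintype.card G + W x) ^ k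
        = ∑ x ∈ C₁, (3 * (Fintype.card G + W x)) ^ k := by rw [mul_sum]; simp_rw [mul_pow]
      _ ≤ ∑ _x ∈ C₁, (4 * Fintype.card G) ^ k := by
          refine sum_le_sum fun x hx => Nat.pow_le_pow_left ?_ k
          rw [hC₁, mem_filter] at hx
          omega
      _ = C₁.card * (4 ^ k * Fintype.card G ^ k) := by rw [sum_const, smul_eq_mul, mul_pow]
      _ ≤ 2 ^ n * (4 ^ k * Fintype.card G ^ k) := by
          refine Nat.mul_le_mul_right _ ?_
          calc C₁.card ≤ (univ : Finset (Fin n → Bool)).card := card_le_univ _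
            _ = 2 ^ n := by simp
      _ = Fintype.card G ^ k * (2 ^ n * 4 ^ k) := by ring
  obtain ⟨gs, -, hgs⟩ := exists_le_of_sum_le univ_nonempty hsum
  refine ⟨gs, fun x hx => ?_⟩
  have hxC : x ∈ C₁ := by rw [hC₁, mem_filter]; exact ⟨mem_univ _, hx⟩
  have hle : 3 ^ k * 2 ^ wr gs x ≤ 2 ^ n * 4 ^ k :=
    le_trans (Nat.mul_le_mul_left _ (single_le_sum (f := fun x => 2 ^ wr gs x)
      (fun _ _ => Nat.zero_le _) hxC)) hgs
  show 2 * wr gs x < k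
  by_contra hge
  push Not at hge
  -- `2 wr ≥ k` gives `18^k ≤ 4^n 16^k`
  have h1 : (3 ^ k * 2 ^ wr gs x) ^ 2 ≤ (2 ^ n * 4 ^ k) ^ 2 := Nat.pow_le_pow_left hle 2
  have e9 : (9 : ℕ) ^ k = (3 ^ k) ^ 2 := by rw [← pow_mul, mul_comm, pow_mul]; norm_num
  have h2 : 18 ^ k ≤ (3 ^ k * 2 ^ wr gs x) ^ 2 := by
    calc 18 ^ k = 9 ^ k * 2 ^ k := by rw [← mul_pow]; norm_num
      _ ≤ 9 ^ k * (2 ^ wr gs x) ^ 2 := Nat.mul_le_mul_left _ (by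
          rw [← pow_mul]; exact Nat.pow_le_pow_right (by norm_num) (by omega))
      _ = (3 ^ k * 2 ^ wr gs x) ^ 2 := by rw [e9, ← mul_pow]
  have h3 : (2 ^ n * 4 ^ k) ^ 2 = 4 ^ n * 16 ^ k := by
    rw [mul_pow, ← pow_mul, ← pow_mul, mul_comm n 2, mul_comm k 2, pow_mul, pow_mul]; norm_num
  have := four_pow_mul_sixteen_pow_lt n k hn hk
  omega

/-! ### Case II: covering by random error sets -/

/-- **Case II selection.** If every `x ∈ S` is hit by at least a `1/K` fraction of a finite
family, and `|S| (K-1)^{k'} < K^{k'}`, then some `k'` members of the family hit all of `S`: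
`Σ_{c⃗} #{x ∈ S uncovered} = Σ_{x∈S} miss_x^{k'} ≤ |S| ((K-1)|Ω|/K)^{k'} < |Ω|^{k'}`.
[cite: Pich2024, §3.1, proof of Thm. 2, Case II (p. 9: "random δ covers such x with high probability … there are δ_1, …, δ_{O(nn₀)} covering all x's considered in Case II")] -/
theorem exists_cover {Ω α : Type*} [Fintype Ω] [Nonempty Ω] (S : Finset α) (hit : Ω → α → Prop)
    [∀ ω x, Decidable (hit ω x)] (K k' : ℕ)
    (hK : ∀ x ∈ S, Fintype.card Ω ≤ K * (univ.filter fun ω => hit ω x).card)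
    (hnum : S.card * (K - 1) ^ k' < K ^ k') :
    ∃ c : Fin k' → Ω, ∀ x ∈ S, ∃ i, hit (c i) x := by
  classical
  set miss : α → ℕ := fun x => (univ.filter fun ω => ¬ hit ω x).card with hmiss
  set unc : (Fin k' → Ω) → ℕ := fun c => (S.filter fun x => ∀ i, ¬ hit (c i) x).card with hunc
  have hmissK : ∀ x ∈ S, K * miss x ≤ (K - 1) * Fintype.card Ω := by
    intro x hx
    have hsplit : (univ.filter fun ω => hit ω x).card + miss x = Fintype.card Ω := by
      rw [hmiss]
      exact card_filter_add_card_filter_not _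
    have := hK x hx
    have hK1 : 1 ≤ K := by
      by_contra h0
      push Not at h0
      interval_cases K
      simp at this
    obtain ⟨K', rfl⟩ : ∃ K', K = K' + 1 := ⟨K - 1, by omega⟩
    simp only [Nat.add_sub_cancel]
    nlinarith
  -- the count of uncovered points, summed over all choices
  have hsum : ∑ c : Fin k' → Ω, unc c = ∑ x ∈ S, miss x ^ k' := by
    rw [hunc]
    simp only [card_filter]
    rw [sum_comm]
    refine sum_congr rfl fun x _ => ?_
    have h1 : ∀ c : Fin k' → Ω, (if ∀ i, ¬ hit (c i) x then 1 else 0) =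
        ∏ i, (if ¬ hit (c i) x then 1 else 0) := fun c => by
      rw [prod_boole]; simp
    simp_rw [h1]
    rw [← Fintype.prod_sum fun (_ : Fin k') (ω : Ω) => if ¬ hit ω x then 1 else 0, prod_const,
      card_univ, Fintype.card_fin, hmiss]
    simp only [card_filter]
  have hlt : ∑ c : Fin k' → Ω, unc c < ∑ _c : Fin k' → Ω, 1 := by
    rw [hsum, sum_const, card_univ, Fintype.card_fun, Fintype.card_fin, smul_eq_mul, mul_one]
    -- multiply by `K^{k'}`
    have hKpos : 0 < K ^ k' := pos_of_gt hnum
    refine Nat.lt_of_mul_lt_mul_left (a := K ^ k') ?_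
    calc K ^ k' * ∑ x ∈ S, miss x ^ k' = ∑ x ∈ S, (K * miss x) ^ k' := by
          rw [mul_sum]; simp_rw [mul_pow]
      _ ≤ ∑ _x ∈ S, ((K - 1) * Fintype.card Ω) ^ k' :=
          sum_le_sum fun x hx => Nat.pow_le_pow_left (hmissK x hx) _
      _ = S.card * (K - 1) ^ k' * Fintype.card Ω ^ k' := by rw [sum_const, smul_eq_mul, mul_pow]; ring
      _ < K ^ k' * Fintype.card Ω ^ k' :=
          Nat.mul_lt_mul_of_pos_right hnum (by positivity)
  obtain ⟨c, -, hc⟩ := exists_lt_of_sum_lt hlt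
  refine ⟨c, fun x hx => ?_⟩
  have h0 : unc c = 0 := by omega
  rw [hunc, card_eq_zero, filter_eq_empty_iff] at h0
  have := h0 hx
  push Not at this
  exact this


end ApproximationMethod

/-! ### A Boolean function depends only on its essential inputs -/

/-- **`f` depends only on its `n₀` essential inputs** (switching an inessential input never
changes `f`; `apply_eq_of_agree_essential`). [cite: Pich2024, §3.1 Thm. 2 (p. 9: "inputs of f such that switching the value of the input affects the output of f on some assignment")] -/
theorem dependsOn_essentialInputs (f : (Fin n → Bool) → Bool) :
    DependsOn f (↑(essentialInputs f) : Set (Fin n)) := fun x y hxy =>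
  (apply_eq_of_agree_essential f x y fun i hi =>
    hxy i (mem_coe.2 ((mem_essentialInputs f i).2 hi))).symm

/-- Reading `f` as an abstract function `f₀` of `|E|` variables through an enumeration
`σ : Fin |E| → Fin n` of a set `E` it depends on: `f(x) = f₀(x ∘ σ)`. [folklore] -/
theorem exists_comp_of_dependsOn (f : (Fin n → Bool) → Bool) (E : Finset (Fin n))
    (hE : DependsOn f (↑E : Set (Fin n))) :
    ∃ (σ : Fin E.card → Fin n) (f₀ : (Fin E.card → Bool) → Bool), ∀ x, f x = f₀ fun i => x (σ i) := by
  classical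
  let e := E.orderIsoOfFin rfl
  refine ⟨fun i => (e i).1, fun y => f fun j => if h : j ∈ E then y (e.symm ⟨j, h⟩) else false,
    fun x => hE fun j hj => ?_⟩
  rw [mem_coe] at hj
  simp only [hj, dif_pos, OrderIso.apply_symm_apply]

/-! ### The theorem -/

open ApproximationMethod in
/-- **Thm. 2 with the constant made explicit**: if `f = τ ∘ σ` reads only `N ≤ n` of its inputs
(`τ` a truth table of `N` variables), then `ρ(f, 𝓜) ≤ 500·N·n` for every legitimate model `𝓜` of
order `n`. [cite: Pich2024, §3.1 Thm. 2 with proof (pp. 9–10)] -/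
theorem ApproximationMethod.covers_of_eval (M : LegitimateModel n) {N : ℕ} (σ : Fin N → Fin n)
    (τ : TruthTable N) (f : (Fin n → Bool) → Bool)
    (hf : ∀ x, f x = TruthTable.eval N τ (x ∘ σ)) (hNn : N ≤ n) : M.Covers f (500 * N * n) := by
  classical
  have hfeq : f = fun x => TruthTable.eval N τ (x ∘ σ) := funext hf
  -- the trivial tree bound `ρ ≤ 3·2^N - 3`
  have htree : M.Covers f (3 * 2 ^ N - 3) := by
    have h := covers_eval_allTuples M N σ τ
    rwa [← hfeq] at h
  by_cases hB : 3 * 2 ^ N - 3 ≤ 500 * N * n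
  · exact htree.mono M hB
  -- hence `N ≥ 1`, `n ≥ 1`, `n < 2^N`
  have hN1 : 1 ≤ N := by
    rcases Nat.eq_zero_or_pos N with h0 | h0
    · exfalso; apply hB; rw [h0]; norm_num
    · exact h0
  have hn1 : 1 ≤ n := hN1.trans hNn
  have hnN : n < 2 ^ N := by
    by_contra hge
    push Not at hge
    apply hB
    calc 3 * 2 ^ N - 3 ≤ 3 * n := by omega
      _ ≤ 3 * (N * n) := Nat.mul_le_mul_left _ (Nat.le_mul_of_pos_left n hN1)
      _ ≤ 500 * N * n := by nlinarith
  -- parameters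
  set L := Nat.size (12 * n) with hL
  have hL1 : 1 ≤ L := Nat.size_pos.2 (by omega)
  have h12 : 12 * n < 2 ^ L := Nat.lt_size_self _
  have hLN : L ≤ N + 4 := by
    rw [hL, Nat.size_le]
    calc 12 * n < 16 * 2 ^ N := by omega
      _ = 2 ^ (N + 4) := by rw [pow_add]; norm_num; ring
  have hhalf : 2 ^ (L - 1) ≤ 12 * n := Nat.lt_size.1 (by omega)
  set k := 2 ^ L - 1 with hk
  have hk1 : k + 1 = 2 ^ L := by
    have : 1 ≤ 2 ^ L := Nat.one_le_two_pow
    omega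
  have hk12 : 12 * n ≤ k := by omega
  have hk24 : k ≤ 24 * n := by
    have : 2 ^ L = 2 * 2 ^ (L - 1) := by
      rw [← pow_succ']; congr 1; omega
    omega
  set K := 36 * (N + 1) with hK
  -- the zero table
  let z : TruthTable N := TruthTable.ofFun N fun _ => false
  have hz : ∀ y, TruthTable.eval N z y = false := fun y => TruthTable.eval_ofFun N _ y
  -- Case I: the voters and the threshold device
  obtain ⟨gs, hgs⟩ := exists_voters (G := TruthTable N) n k hn1 hk12
    fun g x => topApprox M σ τ z g x ≠ TruthTable.eval N τ (x ∘ σ)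
  obtain ⟨g, hg, l₁, hl₁, hl₁mem, hdev⟩ := exists_threshold_device M L k hL1 hk1
    (fun i => topApprox M σ τ z (gs i)) fun i => topApprox_mem M σ τ z (gs i)
  -- Case II: the inputs where at least a third of the `D̄_g` err
  set Gc := Fintype.card (TruthTable N) with hGc
  set S : Finset (Fin n → Bool) := univ.filter fun x => ¬ 3 * badCount M σ τ z x < Gc with hS
  have hcard : Fintype.card (Space N) = Gc * (3 * (N + 1)) := by rw [card_space, hGc]
  have hKx : ∀ x ∈ S, Fintype.card (Space N) ≤
      K * (univ.filter fun ω : Space N => x ∈ tupleErr M (fam M σ τ z ω)).card := by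
    intro x hx
    rw [hS, mem_filter] at hx
    have h1 : Gc ≤ 3 * badCount M σ τ z x := not_lt.1 hx.2
    have h2 := badCount_le M σ τ z hz x
    rw [hcard, hK]
    unfold hitCount at h2
    nlinarith
  have hnum : S.card * (K - 1) ^ (K * n) < K ^ (K * n) := by
    have hS2 : S.card ≤ 2 ^ n := (card_le_univ S).trans (by simp)
    have hKK := two_mul_pow_lt_pow K (by omega)
    calc S.card * (K - 1) ^ (K * n) ≤ 2 ^ n * (K - 1) ^ (K * n) := Nat.mul_le_mul_right _ hS2
      _ = (2 * (K - 1) ^ K) ^ n := by rw [mul_pow, ← pow_mul]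
      _ < (K ^ K) ^ n := Nat.pow_lt_pow_left hKK (by omega)
      _ = K ^ (K * n) := by rw [← pow_mul]
  obtain ⟨c, hc⟩ := exists_cover S (fun (ω : Space N) x => x ∈ tupleErr M (fam M σ τ z ω)) K (K * n)
    hKx hnum
  -- the cover
  refine ⟨g, hg, l₁ ++ List.ofFn fun i => fam M σ τ z (c i), ?_, ?_, ?_⟩
  · -- budget
    rw [List.length_append, List.length_ofFn, hl₁]
    calc 3 * L * k + K * n ≤ 3 * (N + 4) * (24 * n) + 36 * (N + 1) * n := by rw [hK]; gcongr
      _ = (108 * N + 324) * n := by ring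
      _ ≤ 500 * N * n := Nat.mul_le_mul_right _ (by omega)
  · -- components in `𝓜`
    intro τ' hτ'
    rw [List.mem_append, List.mem_ofFn] at hτ'
    rcases hτ' with hτ' | ⟨i, rfl⟩
    · exact hl₁mem τ' hτ'
    · exact fam_mem M σ τ z (c i)
  · -- every `x ∈ f ⊕ g` is covered
    intro x hx
    by_cases hxS : x ∈ S
    · obtain ⟨i, hi⟩ := hc x hxS
      exact ⟨_, List.mem_append_right _ (List.mem_ofFn.2 ⟨i, rfl⟩), hi⟩
    · have hlt : 3 * badCount M σ τ z x < Gc := by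
        by_contra h'; exact hxS (by rw [hS, mem_filter]; exact ⟨mem_univ _, h'⟩)
      have hvote := hgs x hlt
      by_contra hno
      have havoid : ∀ τ' ∈ l₁, x ∉ M.errSet τ'.1 τ'.2.1 τ'.2.2 := fun τ' hτ' hmem =>
        hno ⟨τ', List.mem_append_left _ hτ', hmem⟩
      have hgx := hdev x (f x) havoid (by rw [hf x]; exact hvote)
      exact hx hgx.symm

open ApproximationMethod in
/-- **The limit of the method of approximations (Razborov 1989; Pich 2024, Thm. 2): `ρ(f, 𝓜) ≤ O(n₀ n)`,
proved** with the absolute constant `c = 500`: for every legitimate model `𝓜` of order `n` over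
`{¬, ∨₂, ∧₂}` with `¬̄ = ¬` and every `f ∈ F_n` with `n₀` essential inputs, `f ⊕ g` is covered by
`≤ 500·n₀·n` error sets over `𝓜` for some `g ∈ 𝓜`. Proof (Pich's, with the probabilistic steps
done by counting): `f` is the truth table `τ` of its `n₀` essential inputs read through `σ`; if
`3·2^{n₀} − 3 ≤ 500 n₀ n` the whole tree `C̄_τ` covers (`covers_eval_allTuples`); otherwise
`n < 2^{n₀}`, and with `k = 2^L − 1 ∈ [12n, 24n]` voters `D̄_{g_i}` chosen by the exponential
moment (`exists_voters`, Case I), the top bit `g` of their binary counter inside `𝓜`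
(`3Lk ≤ 72(n₀+4) n` tuples, `exists_threshold_device`) agrees with `f` off the device's error
sets wherever fewer than a third of all `D̄_g` err, while the remaining inputs are covered by
`36(n₀+1)·n` error sets drawn from the Lemma-1 family (`badCount_le`, `exists_cover`, Case II).
[cite: Pich2024, §3.1 Thm. 2 with proof, Lemma 1, Claim 3.1 (pp. 9–10)] [cite: Razborov1989, main theorem (as restated in Pich2024 Thm. 2)] -/
theorem ApproximationMethodLimit_holds : ApproximationMethodLimit := by
  refine ⟨500, fun n M f => ?_⟩
  obtain ⟨σ, f₀, hf⟩ := exists_comp_of_dependsOn f (essentialInputs f) (dependsOn_essentialInputs f)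
  refine covers_of_eval M σ (TruthTable.ofFun _ f₀) f (fun x => ?_) ((card_le_univ _).trans (by simp))
  rw [TruthTable.eval_ofFun]
  exact hf x

end Literature.Barriers.PneNP

end
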